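import Summits.AtomisticToContinuum.BoseEinsteinCondensation.Theorems.BECCutLineWeakDisorderAcrossCutMeanProfileFreeGas
import Literature.MathematicalPhysics.QuantumManyBody.BoseGasHardCoreIntegrableTail
import HarnessLib

/-!
# Route `BECCutLineWeakDisorder`, crux `TwoReplicaTransienceBound` (stmt-AtomisticToContinuum-9687),
# line `across-cut-thinning` (v2): audit lemmas and the FREE-GAS row of the conjecture input
# `stub_blockTwoReplicaSingular` (`BlockTwoReplicaBoundSingular`)

Support file (`--supports stmt-AtomisticToContinuum-9687`; proves the registered TOOLBOX stubs
`stub_blockTwoReplicaNoJunk` and `stub_blockTwoReplicaFree` (explicit signatures, no new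
definitions), NOT the registered conjecture stub
`stub_blockTwoReplicaSingular : Goal.stub_blockTwoReplicaSingular` of
`Theorems/BECCutLineWeakDisorderAcrossCutDefs.lean`, which is the annealed kinetic-block two-replica
bound `(∫ Z_n²)(∫ A_Q²) ≤ c (∫ A_Q Z_n)²` for unbounded (hard-core type) admissible `v`, uniformly
in `n` — block-level ODLRO of the Feynman–Kac witness, BEC-strength, open).

What is here (all kernel-checked, elementary):
* **no junk direction** (`blockAmp_le_volume_mul_fkPartition`, `lintegral_blockAmp_sq_le`,
  `lintegral_blockAmp_sq_eq_zero`; registered toolbox stub `stub_blockTwoReplicaNoJunk`):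
  `A_Q(Y) ≤ |Q| Z_n(Y)` (landed `stub_factorisation` + `tracer ≤ 1`), hence
  `∫ A_Q² dY ≤ |Q| · ∫ A_Q Z_n dY = |Q| · meanAmp`; so `meanAmp = 0` forces `∫ A_Q² = 0` and the
  stub's inequality is never decided by the `[0,∞]` conventions (its left side vanishes whenever its
  right side does);
* **the unboundedness hypothesis is Feynman–Kac-idle on the negative half-line**
  (`fkPartition_congr_nonneg`, `bathTwo_congr_nonneg`, `blockAmp_congr_nonneg`,
  `meanAmp_congr_nonneg`, over the tree's `BoseGas.interaction_congr_nonneg`;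
  `exists_admissible_unbounded_fkFree`): every Feynman–Kac object sees `v` only through `v ∘ dist`,
  i.e. on `[0, ∞)`; the potential
  `⊤ · 𝟙_{(-∞,0)}` is admissible (`IsRepulsiveFiniteRange`, range `0`), NOT bounded, and FK-equal to
  the free gas — so the class `¬ ∃ C, ∀ r, v r ≤ C` of the stub contains FK-free (indeed FK-bounded)
  potentials (audit remark for the lead: the by-cases split on literal boundedness is sound, but the
  singular stub logically also covers every bounded `v` up to this congruence);
* **the free row, equality with `c = 1`** (`blockTwoReplica_free`,
  `blockTwoReplica_eq_of_vanish_nonneg`; registered toolbox stub `stub_blockTwoReplicaFree`): for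
  `v ≡ 0` the insertion slice factorises, `Z_{n+1}(x::Y) = θ_T(x) Z_n(Y)`, so
  `A_Q(Y) = a_Q Z_n(Y)` with the deterministic block mass `a_Q = ∫_Q θ_T` and `meanAmp = a_Q ∫Z_n²`
  (landed `blockAmp_free`, `meanAmp_free` of `…AcrossCutMeanProfileFreeGas.lean`), whence
  `(∫ Z_n²)(∫ A_Q²) = (∫ A_Q Z_n)²` EXACTLY, for every `n`, `L`, `T`, level `j` and block `i`; by
  the congruence the same equality holds for every `v` vanishing on `[0, ∞)` (the FK-free members of
  the stub's class).

NOT here: the conjecture stub itself (uniformity in `n` is ground-state BEC / a non-vanishing local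
order parameter for the dilute hard-sphere gas — open, [LSSY2005] §1.2 and Ch. 5).
-/

noncomputable section

open MeasureTheory Filter Set Finset
open scoped ENNReal NNReal Topology BigOperators

namespace Summit.AtomisticToContinuum.BoseEinsteinCondensation.Cruxes.TwoReplicaTransienceBound.AcrossCutThinning

open Literature.MathematicalPhysics.QuantumManyBody.BoseGas
open Summit.AtomisticToContinuum.BoseEinsteinCondensation.Theses.BECCutLineWeakDisorder
open Summit.AtomisticToContinuum.BoseEinsteinCondensation.Cruxes.TwoReplicaTransienceBound.TracerDecoupling
open Summit.AtomisticToContinuum.BoseEinsteinCondensation.Cruxes.TwoReplicaTransienceBound.TaggedShiftLogHarnack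
  (volume_dyadicCube)
open Summit.AtomisticToContinuum.BoseEinsteinCondensation.Cruxes.LandscapeBound.SiblingTelescopingChaining

variable {n : ℕ}

/-! ### 1. No junk: the block amplitude is dominated by the bath partition function -/

/-- `A_Q(Y) ≤ |Q| · Z_n(Y)`: adding the tagged line only lowers the partition function
(`Z_{n+1}(x::Y) = ∫ w · tracer ≤ ∫ w = Z_n(Y)` by the landed `stub_factorisation` and `tracer ≤ 1`),
integrated over the block. -/
theorem blockAmp_le_volume_mul_fkPartition {v : ℝ → ℝ≥0∞} (hv : Measurable v) (L T : ℝ) (j : ℕ)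
    (i : Fin 3 → Fin (2 ^ j)) (Y : Config n) :
    blockAmp v L T j i Y ≤ volume (dyadicCube L j i) * fkPartition v L T Y := by
  unfold blockAmp blockMass partSlice
  have hle : ∀ x : Space, fkPartition v L T (Matrix.vecCons x Y) ≤ fkPartition v L T Y := by
    intro x
    rw [stub_factorisation n v hv L T x Y]
    calc ∫⁻ ωb, fkWeight v L T Y ωb * tracer v L T x Y ωb ∂wienerPaths n
        ≤ ∫⁻ ωb, fkWeight v L T Y ωb * 1 ∂wienerPaths n :=
          lintegral_mono fun ωb => mul_le_mul' le_rfl (tracer_le_one v L T x Y ωb)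
      _ = fkPartition v L T Y := by simp [fkPartition, fkSemigroup]
  calc ∫⁻ x in dyadicCube L j i, fkPartition v L T (Matrix.vecCons x Y)
      ≤ ∫⁻ _ in dyadicCube L j i, fkPartition v L T Y := lintegral_mono fun x => hle x
    _ = fkPartition v L T Y * volume (dyadicCube L j i) := setLIntegral_const _ _
    _ = volume (dyadicCube L j i) * fkPartition v L T Y := mul_comm _ _

/-- `∫ A_Q(Y)² dY ≤ |Q| · ∫ A_Q(Y) Z_n(Y) dY = |Q| · meanAmp` (`L ≥ 0`, so that
`|Q| = (L2^{-j})³`). -/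
theorem lintegral_blockAmp_sq_le {v : ℝ → ℝ≥0∞} (hv : Measurable v) {L : ℝ} (hL : 0 ≤ L) (T : ℝ)
    (j : ℕ) (i : Fin 3 → Fin (2 ^ j)) (n : ℕ) :
    ∫⁻ Y : Config n, blockAmp v L T j i Y ^ 2 ≤
      ENNReal.ofReal ((L / 2 ^ j) ^ 3) * meanAmp v L T j i n := by
  unfold meanAmp
  rw [← lintegral_const_mul' _ _ ENNReal.ofReal_ne_top]
  refine lintegral_mono fun Y => ?_
  calc blockAmp v L T j i Y ^ 2 = blockAmp v L T j i Y * blockAmp v L T j i Y := sq _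
    _ ≤ blockAmp v L T j i Y * (volume (dyadicCube L j i) * fkPartition v L T Y) :=
        mul_le_mul' le_rfl (blockAmp_le_volume_mul_fkPartition hv L T j i Y)
    _ = ENNReal.ofReal ((L / 2 ^ j) ^ 3) * (blockAmp v L T j i Y * fkPartition v L T Y) := by
        rw [volume_dyadicCube hL]; ring

/-- **No junk direction.** If the mean insertion amplitude of the block vanishes, so does
`∫ A_Q² dY` — hence the left side `bathTwo · ∫ A_Q²` of `BlockTwoReplicaBoundSingular` vanishes
whenever its right side `c · meanAmp²` does: the inequality is never settled by `[0, ∞]`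
conventions. -/
theorem lintegral_blockAmp_sq_eq_zero {v : ℝ → ℝ≥0∞} (hv : Measurable v) {L : ℝ} (hL : 0 ≤ L)
    (T : ℝ) (j : ℕ) (i : Fin 3 → Fin (2 ^ j)) (n : ℕ) (h : meanAmp v L T j i n = 0) :
    ∫⁻ Y : Config n, blockAmp v L T j i Y ^ 2 = 0 :=
  le_antisymm ((lintegral_blockAmp_sq_le hv hL T j i n).trans (by simp [h])) bot_le

/-- **Registered toolbox stub `stub_blockTwoReplicaNoJunk`** (no-junk audit of
`stub_blockTwoReplicaSingular`; = `lintegral_blockAmp_sq_le` and `lintegral_blockAmp_sq_eq_zero`):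
for measurable `v` and `L ≥ 0`, `∫ A_Q(Y)² dY ≤ |Q| · ∫ A_Q(Y) Z_n(Y) dY` (`|Q| = (L2^{-j})³`), for
every `n`, `T`, level `j` and block `i`; in particular the left side `(∫ Z_n²) · ∫ A_Q²` of the
block two-replica bound vanishes whenever its right side `c · (∫ A_Q Z_n)²` does — the inequality is
never settled by `[0, ∞]` conventions. -/
theorem stub_blockTwoReplicaNoJunk : ∀ (n : ℕ) (v : ℝ → ℝ≥0∞), Measurable v → ∀ L : ℝ, 0 ≤ L →
    ∀ (T : ℝ) (j : ℕ) (i : Fin 3 → Fin (2 ^ j)),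
      ∫⁻ Y : Config n, blockAmp v L T j i Y ^ 2 ≤
          ENNReal.ofReal ((L / 2 ^ j) ^ 3) * meanAmp v L T j i n ∧
        (meanAmp v L T j i n = 0 →
          bathTwo v L T n * ∫⁻ Y : Config n, blockAmp v L T j i Y ^ 2 = 0) :=
  fun n _ hv _ hL T j i => ⟨lintegral_blockAmp_sq_le hv hL T j i n,
    fun h => by rw [lintegral_blockAmp_sq_eq_zero hv hL T j i n h, mul_zero]⟩

/-! ### 2. The Feynman–Kac objects see `v` only on `[0, ∞)` -/

/-- Two pair potentials that agree on `[0, ∞)` have the same partition functions `Z_T(X)` (the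
interaction only sees `v ∘ dist`: the tree's `BoseGas.interaction_congr_nonneg`). -/
theorem fkPartition_congr_nonneg {N : ℕ} {v v' : ℝ → ℝ≥0∞} (h : ∀ r, 0 ≤ r → v r = v' r)
    (L T : ℝ) (X : Config N) : fkPartition v L T X = fkPartition v' L T X := by
  simp only [fkPartition, fkSemigroup, fkWeight, pathAction, interaction_congr_nonneg h]

/-- … hence the same bath-only `2T`-bridge mass `∫ Z_n²`. -/
theorem bathTwo_congr_nonneg {v v' : ℝ → ℝ≥0∞} (h : ∀ r, 0 ≤ r → v r = v' r) (L T : ℝ) (n : ℕ) :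
    bathTwo v L T n = bathTwo v' L T n := by
  simp only [bathTwo, fkPartition_congr_nonneg h]

/-- … hence the same block insertion amplitudes `A_Q(Y)`. -/
theorem blockAmp_congr_nonneg {v v' : ℝ → ℝ≥0∞} (h : ∀ r, 0 ≤ r → v r = v' r) (L T : ℝ) (j : ℕ)
    (i : Fin 3 → Fin (2 ^ j)) (Y : Config n) : blockAmp v L T j i Y = blockAmp v' L T j i Y := by
  simp only [blockAmp, blockMass, partSlice, fkPartition_congr_nonneg h]

/-- … hence the same mean insertion amplitudes `∫ A_Q Z_n`. -/
theorem meanAmp_congr_nonneg {v v' : ℝ → ℝ≥0∞} (h : ∀ r, 0 ≤ r → v r = v' r) (L T : ℝ) (j : ℕ)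
    (i : Fin 3 → Fin (2 ^ j)) (n : ℕ) : meanAmp v L T j i n = meanAmp v' L T j i n := by
  simp only [meanAmp, blockAmp_congr_nonneg h, fkPartition_congr_nonneg h]

/-- **The stub's class contains Feynman–Kac-free potentials.** `v♯ = ⊤ · 𝟙_{(-∞,0)}` is admissible
(measurable, range `0`), is NOT bounded, and agrees with the free gas `v ≡ 0` on `[0, ∞)` — so
`¬ ∃ C, ∀ r, v r ≤ C` does not exclude the free (nor, adding `v♯`, any bounded) gas from
`BlockTwoReplicaBoundSingular`; only `v` on `[0, ∞)` is physical. -/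
theorem exists_admissible_unbounded_fkFree :
    ∃ v : ℝ → ℝ≥0∞, IsRepulsiveFiniteRange v ∧ (¬ ∃ C : ℝ≥0, ∀ r, v r ≤ C) ∧
      ∀ r, 0 ≤ r → v r = 0 := by
  refine ⟨Set.indicator (Set.Iio 0) (fun _ => ⊤), ⟨measurable_const.indicator measurableSet_Iio,
    0, fun r hr => Set.indicator_of_notMem (show r ∉ Set.Iio (0 : ℝ) from not_lt.2 hr.le) _⟩, ?_,
    fun r hr => Set.indicator_of_notMem (show r ∉ Set.Iio (0 : ℝ) from not_lt.2 hr) _⟩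
  rintro ⟨C, hC⟩
  have h := hC (-1)
  rw [Set.indicator_of_mem (show (-1 : ℝ) ∈ Set.Iio 0 by norm_num)] at h
  exact ENNReal.coe_ne_top (top_le_iff.1 h)

/-! ### 3. The free row: equality with constant one -/

/-- **The free row**: for the free gas `(∫ Z_n²) · ∫ A_Q(Y)² dY = (∫ A_Q Z_n dY)²` — the `c = 1`
(equality) row of `BlockTwoReplicaBoundSingular` / `BlockOfCovarianceReduction`, for every `n`, `L`,
`T`, level and block (`A_Q = a_Q Z_n`, `meanAmp = a_Q ∫Z_n²`: landed `blockAmp_free`,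
`meanAmp_free`). -/
theorem blockTwoReplica_free (n : ℕ) (L T : ℝ) (j : ℕ) (i : Fin 3 → Fin (2 ^ j)) :
    bathTwo (fun _ => 0) L T n * ∫⁻ Y : Config n, blockAmp (fun _ => 0) L T j i Y ^ 2 =
      meanAmp (fun _ => 0) L T j i n ^ 2 := by
  rw [meanAmp_free]
  simp_rw [blockAmp_free, mul_pow]
  rw [lintegral_const_mul _ ((measurable_fkPartition_bath measurable_const L T).pow_const 2)]
  simp only [bathTwo]
  ring

/-- The free row transported along the congruence: for EVERY `v` vanishing on `[0, ∞)` (the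
Feynman–Kac-free members of the stub's class, e.g. `⊤ · 𝟙_{(-∞,0)}`), the block two-replica bound
holds with equality and constant `1`, for all `n, L, T`, levels and blocks. -/
theorem blockTwoReplica_eq_of_vanish_nonneg {v : ℝ → ℝ≥0∞} (h : ∀ r, 0 ≤ r → v r = 0) (n : ℕ)
    (L T : ℝ) (j : ℕ) (i : Fin 3 → Fin (2 ^ j)) :
    bathTwo v L T n * ∫⁻ Y : Config n, blockAmp v L T j i Y ^ 2 = meanAmp v L T j i n ^ 2 := by
  have h' : ∀ r, 0 ≤ r → v r = (fun _ : ℝ => (0 : ℝ≥0∞)) r := h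
  simp_rw [bathTwo_congr_nonneg h', blockAmp_congr_nonneg h', meanAmp_congr_nonneg h']
  exact blockTwoReplica_free n L T j i

/-- **Registered toolbox stub `stub_blockTwoReplicaFree`** (calibration row of
`stub_blockTwoReplicaSingular`): the stub's class `IsRepulsiveFiniteRange v ∧ ¬ ∃ C, ∀ r, v r ≤ C`
CONTAINS Feynman–Kac-free potentials (`v = 0` on `[0, ∞)`, e.g. `⊤ · 𝟙_{(-∞,0)}`;
`exists_admissible_unbounded_fkFree`), and for every such potential the annealed block two-replica
bound is an EQUALITY with constant `1`, for every particle number, box, polymer half-length, dyadic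
level and block (`blockTwoReplica_eq_of_vanish_nonneg`). -/
theorem stub_blockTwoReplicaFree :
    (∃ v : ℝ → ℝ≥0∞, IsRepulsiveFiniteRange v ∧ (¬ ∃ C : ℝ≥0, ∀ r, v r ≤ C) ∧
      ∀ r, 0 ≤ r → v r = 0) ∧
    ∀ v : ℝ → ℝ≥0∞, (∀ r, 0 ≤ r → v r = 0) →
      ∀ (n : ℕ) (L T : ℝ) (j : ℕ) (i : Fin 3 → Fin (2 ^ j)),
        bathTwo v L T n * ∫⁻ Y : Config n, blockAmp v L T j i Y ^ 2 = meanAmp v L T j i n ^ 2 :=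
  ⟨exists_admissible_unbounded_fkFree,
    fun _ h n L T j i => blockTwoReplica_eq_of_vanish_nonneg h n L T j i⟩

end Summit.AtomisticToContinuum.BoseEinsteinCondensation.Cruxes.TwoReplicaTransienceBound.AcrossCutThinning

end
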